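import Literature.Topology.FourManifolds.LoopSurgeryHomotopySphere
import Literature.Topology.FourManifolds.LargeKTrisectionClassification
import Literature.Topology.FourManifolds.SmallTrisectionsChiZero
import Literature.Topology.FourManifolds.CircleProdSumEuler
import Literature.Topology.FourManifolds.SphereOneProdSphereThreeLoopSurgery
import Literature.Topology.FourManifolds.LoopSurgeryFibreClass
import Literature.Topology.FourManifolds.LoopSurgeryTrisectionEulerProofs
import Literature.Topology.FourManifolds.SphereSimplyConnected
import HarnessLib

/-!
# Proofs for `LoopSurgeryHomotopySphere.lean`, III: the loop-presentation corollary of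
# Meier–Schirmer–Zupan's Thm. 1.2, reduced to the classification theorem itself

Sibling proof file of `Literature/Topology/FourManifolds/LoopSurgeryHomotopySphere.lean`
(D-0014).  The named fact `Literature.Topology.FourManifolds.msz_loopSurgery_homotopySphere_gk`
— *if a closed connected orientable smooth `X` carries a `(g; k₀, k₁, k₂)`-GK-trisection with
some `kᵢ + 1 ≥ g`, and a surgery `M = X_ℓ` on a smoothly embedded loop `ℓ ⊂ X` is a homotopy
4-sphere, then `M ≅ S⁴`* — is a COROLLARY of Meier–Schirmer–Zupan 2016, Thm. 1.2 (the
classification of such `X` as `#^{k′}(S¹ × S³)` or `#^{k′}(S¹ × S³) # (±ℂP²)`), which the tree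
holds as the (unproved) named fact
`Literature.Topology.FourManifolds.msz_trisection_classification_gk`
(`LargeKTrisectionClassification.lean`; its printed proof is Gabai's Property R, Scharlemann–
Thompson, Laudenbach–Poénaru and Waldhausen's theorem, none of it in the tree).  This file proves
the corollary FROM the classification, following the argument printed in the fact's docstring
line by line, with every other input PROVED in the tree:

`msz_loopSurgery_homotopySphere_gk_of_classification :
  msz_trisection_classification_gk.{0} → msz_loopSurgery_homotopySphere_gk`.

1. *"`χ(X_ℓ) = χ(X) + 2` and `χ(M) = 2` give `χ(X) = 0`"* —
   `finRelHomology_and_relEuler_of_isCircleSurgery` (`CircleSurgeryEulerCharacteristic.lean`,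
   Gompf–Stipsicz §5.2) and `finRelHomology_of_homotopyEquiv_sphere_four` (Hatcher Cor. 2.11);
   `M` is compact by `compactSpace_of_homotopyEquiv_sphere_four_holds`.
2. *"`χ(X) = 2 − 2k′ + ε = 0`, so `ε = 0`, `k′ = 1`, `X ≅ S¹ × S³`"* — the classification
   (`msz_trisection_classification_gk.of_exists`) and the Euler characteristics
   `χ(#ᵏ(S¹ × S³)) = 2 − 2k`, `χ(#ᵏ(S¹ × S³) # ℂP²) = 3 − 2k` (`CircleProdSumEuler.lean`), then
   `IsCircleProdSum 1 X ⇒ X ≅ S¹ × S³`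
   (`IsCircleProdSum.nonempty_diffeomorph_sphereOne_prod_sphereThree_of_one`, `S⁴ # N ≅ N`).
3. *"`π₁(M) = π₁(X)/⟨⟨[ℓ]⟩⟩` is trivial, so `[ℓ] = ±1`"* — `M` is simply connected (Hatcher
   Prop. 1.14/1.18), so the winding number of `pr₁ ∘ Φ ∘ ℓ` is `±1`
   (`winding_circleLoop_eq_one_or_neg_one_of_isCircleSurgery`, `LoopSurgeryFibreClass.lean`,
   Kosinski X Lemma 1.2 via Seifert–van Kampen), whence `Φ ∘ ℓ` is homotopic to the fibre circle
   or its reverse (`homotopic_fibre_or_conj_of_winding`, Hatcher Thm. 1.7).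
4. *"loops in a 4-manifold are isotopic iff homotopic, so `M` is one of the two surgeries
   `S_{±1}`, `S′_{±1}` … diffeomorphic to `S⁴`"* (Pao 1977; Aranda–Zupan 2025 §2) —
   `nonempty_diffeomorph_sphereFour_of_isCircleSurgery_of_homotopic_fibre`
   (`SphereOneProdSphereThreeLoopSurgery.lean`).

Steps 3–4 are isolated as
`nonempty_diffeomorph_sphereFour_of_isCircleSurgery_of_diffeomorph_sphereOne_prod_sphereThree`
(a simply connected circle surgery on a copy of `S¹ × S³` is `S⁴`), so that the corollary is
also recorded FROM THE `χ = 0` SLICE of the classification, the (unproved) named fact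
`Literature.Topology.FourManifolds.msz_chiZero_circleProdSphereThree_gk`
(`SmallTrisectionsChiZero.lean`: a trisected `X` in the MSZ range with `k₀ + k₁ + k₂ = g + 2` is
`S¹ × S³`; itself a consequence of the classification, `SmallTrisectionsChiZeroProofs.lean`):

`msz_loopSurgery_homotopySphere_gk_of_chiZero :
  msz_chiZero_circleProdSphereThree_gk.{0} → msz_loopSurgery_homotopySphere_gk`,

the hypothesis `k₀ + k₁ + k₂ = g + 2` being the PROVED
`gkTrisection_sum_eq_add_two_of_loopSurgery_homotopySphere_holds`
(`LoopSurgeryTrisectionEulerProofs.lean`).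

Everything here is proved; no definitions, no named facts.  The discharge
`msz_loopSurgery_homotopySphere_gk_holds` is then `… _of_classification h` (or `… _of_chiZero h`)
for a proof `h` of either input fact, once the tree has one.

## References

* J. Meier, T. Schirmer, A. Zupan, *Classification of trisections and the Generalized Property R
  Conjecture*, Proc. AMS 144 (2016), arXiv:1507.06561, Thm. 1.2. [MeierSchirmerZupan2016]
* P. S. Pao, *The topological structure of 4-manifolds with effective torus actions. I*,
  Trans. AMS 227 (1977). [Pao1977]
* R. Aranda, A. Zupan (2025), §2 p. 7. [ArandaZupan2025]
* R. Gompf, A. Stipsicz, *4-Manifolds and Kirby Calculus* (1999), §5.2. [GompfStipsiczGSM1999]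
* A. Kosinski, *Differential Manifolds* (1993), Ch. X Lemma 1.2. [Kosinski1993]
* A. Hatcher, *Algebraic Topology* (2002), Thm. 1.7, Prop. 1.14, Prop. 1.18, Cor. 2.11.
  [HatcherAT2002]
-/

noncomputable section

open scoped Manifold ContDiff Topology ContinuousMap unitInterval
open Set Function
open Literature.AlgebraicTopology.SingularHomology
open Literature.Topology.FourManifolds.CircleMaps

namespace Literature.Topology.FourManifolds

/-- **The loop partner of a homotopy 4-sphere has `χ = 0`**: if `M = X_ℓ` is a circle surgery on
the compact `X` and `M ≃ S⁴` (homotopy equivalent), then `relEuler ℤ ℤ X ∅ = 0`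
(`χ(X_ℓ) = χ(X) + 2`, Gompf–Stipsicz §5.2; `χ(M) = χ(S⁴) = 2`, Hatcher Cor. 2.11).
[cite: GompfStipsiczGSM1999, §5.2] -/
theorem relEuler_eq_zero_of_isCircleSurgery_of_homotopyEquiv_sphere_four
    {X : Type} [TopologicalSpace X] [T2Space X] [CompactSpace X]
    [ChartedSpace (EuclideanSpace ℝ (Fin 4)) X]
    {ℓ : (Metric.sphere (0 : EuclideanSpace ℝ (Fin 2)) 1) → X}
    {M : Type} [TopologicalSpace M] [T2Space M] [SecondCountableTopology M]
    [ChartedSpace (EuclideanSpace ℝ (Fin 4)) M] [IsManifold (𝓡 4) ∞ M]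
    (e : M ≃ₕ (Metric.sphere (0 : EuclideanSpace ℝ (Fin 5)) 1))
    (hsurg : IsCircleSurgery (𝓡 4) (𝓡 4) X M ℓ) : relEuler ℤ ℤ X ∅ = 0 := by
  haveI : CompactSpace M := compactSpace_of_homotopyEquiv_sphere_four_holds M e
  obtain ⟨-, hχM⟩ := finRelHomology_of_homotopyEquiv_sphere_four e
  obtain ⟨-, -, hχ⟩ := finRelHomology_and_relEuler_of_isCircleSurgery hsurg
  omega

/-- **Steps 1–2 of the corollary: GIVEN MSZ Thm. 1.2, the trisected loop partner `X` of a
homotopy 4-sphere is a copy of `S¹ × S³`.**  With `k′` from the classification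
(`msz_trisection_classification_gk.of_exists`): `χ(X) = 0` (previous lemma) rules out the
`# ℂP²` branch (`χ = 3 − 2k′` is odd) and forces `k′ = 1` in the other (`χ = 2 − 2k′`), and
`#¹(S¹ × S³) = S⁴ # (S¹ × S³) ≅ S¹ × S³`.
[cite: MeierSchirmerZupan2016, Thm. 1.2 (arXiv numbering)] -/
theorem nonempty_diffeomorph_sphereOne_prod_sphereThree_of_classification
    (h : msz_trisection_classification_gk.{0})
    {X : Type} [TopologicalSpace X] [T2Space X] [SecondCountableTopology X]
    [ChartedSpace (EuclideanSpace ℝ (Fin 4)) X] [IsManifold (𝓡 4) ∞ X] [CompactSpace X]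
    [ConnectedSpace X] (hX : IsOrientable (𝓡 4) X) {g : ℕ} {k : Fin 3 → ℕ} {S : Fin 3 → Set X}
    (hT : IsGKTrisection X g k S) (hk : ∃ i, g ≤ k i + 1)
    {ℓ : (Metric.sphere (0 : EuclideanSpace ℝ (Fin 2)) 1) → X}
    {M : Type} [TopologicalSpace M] [T2Space M] [SecondCountableTopology M]
    [ChartedSpace (EuclideanSpace ℝ (Fin 4)) M] [IsManifold (𝓡 4) ∞ M]
    (e : M ≃ₕ (Metric.sphere (0 : EuclideanSpace ℝ (Fin 5)) 1))
    (hsurg : IsCircleSurgery (𝓡 4) (𝓡 4) X M ℓ) :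
    Nonempty (X ≃ₘ⟮𝓡 4, (𝓡 1).prod (𝓡 3)⟯
      ((Metric.sphere (0 : EuclideanSpace ℝ (Fin 2)) 1) ×
        (Metric.sphere (0 : EuclideanSpace ℝ (Fin 4)) 1))) := by
  have hχX := relEuler_eq_zero_of_isCircleSurgery_of_homotopyEquiv_sphere_four e hsurg
  obtain ⟨o⟩ := hX
  obtain ⟨k', hk'⟩ := h.of_exists o hT hk
  have hsum : IsCircleProdSum 1 X := by
    rcases hk' with hk' | ⟨M', _, _, _, _, _, _, _, hM', hcs⟩
    · obtain ⟨-, hχ'⟩ := hk'.finRelHomology_and_relEuler_eq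
      have h1 : k' = 1 := by omega
      subst h1
      exact hk'
    · obtain ⟨-, hχ'⟩ := hM'.relEuler_eq_of_isConnectedSum_complexProjectivePlane hcs
      exfalso
      omega
  exact hsum.nonempty_diffeomorph_sphereOne_prod_sphereThree_of_one

/-- The circle-valued first coordinate `toCircle ∘ pr₁ ∘ Φ` of a copy `Φ : X ≅ S¹ × S³` has a
loop of winding number one: the fibre circle `u ↦ Φ⁻¹(u, q)` (its winding number is that of the
identity of the circle along the standard loop, `CircleMaps.degree_id`). [folklore] -/
theorem exists_winding_fst_eq_one
    {X : Type*} [TopologicalSpace X]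
    (Φ : X ≃ₜ ((Metric.sphere (0 : EuclideanSpace ℝ (Fin 2)) 1) ×
      (Metric.sphere (0 : EuclideanSpace ℝ (Fin 4)) 1)))
    (T : C(Metric.sphere (0 : EuclideanSpace ℝ (Fin 2)) 1, Circle)) (hT : ∀ u, T u = toCircle u)
    (q : Metric.sphere (0 : EuclideanSpace ℝ (Fin 4)) 1) :
    ∃ (x : X) (γ : Path x x),
      winding (T.comp ((⟨Prod.fst, continuous_fst⟩ : C(_, _)).comp
        (⟨⇑Φ, Φ.continuous⟩ : C(X, _)))) γ = 1 := by
  have hc : Continuous fun u : Metric.sphere (0 : EuclideanSpace ℝ (Fin 2)) 1 => Φ.symm (u, q) := by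
    fun_prop
  let fib : C(Metric.sphere (0 : EuclideanSpace ℝ (Fin 2)) 1, X) := ⟨fun u => Φ.symm (u, q), hc⟩
  refine ⟨_, fib.circleLoop, ?_⟩
  have h1 : winding (T.comp ((⟨Prod.fst, continuous_fst⟩ : C(_, _)).comp
      (⟨⇑Φ, Φ.continuous⟩ : C(X, _)))) fib.circleLoop =
        winding (ContinuousMap.id Circle) stdLoop :=
    winding_congr _ _ _ _ fun t => by
      show T (Φ (Φ.symm (circleParam t, q))).1 = stdLoop t
      rw [Φ.apply_symm_apply, hT, toCircle_circleParam]
  rw [h1]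
  exact degree_id

/-- **Steps 3–4 of the corollary: a simply connected circle surgery on a copy of `S¹ × S³` is
`S⁴`.**  Let `Φ : X ≅ S¹ × S³` be a diffeomorphism of the closed connected `X`, `ℓ ⊂ X` a smoothly
embedded loop and `M = X_ℓ` a circle surgery (either framing) with `M` simply connected.  Then
`π₁(M) = π₁(X)/⟨⟨[ℓ]⟩⟩ = 1` (Kosinski X Lemma 1.2) forces the winding number of `pr₁ ∘ Φ ∘ ℓ` to
be `±1` (`winding_circleLoop_eq_one_or_neg_one_of_isCircleSurgery`; the fibre circle has winding
number `1`, `exists_winding_fst_eq_one`), so `Φ ∘ ℓ` is homotopic to the fibre circle or its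
reverse (`homotopic_fibre_or_conj_of_winding`, Hatcher Thm. 1.7 and Prop. 1.14: `S³` is simply
connected and circle maps are classified by degree); homotopic loops in a 4-manifold are isotopic
and both surgeries on the fibre circle of `S¹ × S³` give `S⁴` (Pao 1977; Aranda–Zupan 2025 §2:
"when `p = 1`, we have that `S₁` and `S'₁` are diffeomorphic to `S⁴`";
`nonempty_diffeomorph_sphereFour_of_isCircleSurgery_of_homotopic_fibre`).
[cite: Pao1977, Thm. (S_1 ≅ S'_1 ≅ S⁴)] [cite: ArandaZupan2025, §2 p. 7]
[cite: Kosinski1993, Ch. X §1, Lemma 1.2] -/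
theorem nonempty_diffeomorph_sphereFour_of_isCircleSurgery_of_diffeomorph_sphereOne_prod_sphereThree
    {X : Type} [TopologicalSpace X] [T2Space X] [SecondCountableTopology X]
    [ChartedSpace (EuclideanSpace ℝ (Fin 4)) X] [IsManifold (𝓡 4) ∞ X] [CompactSpace X]
    [ConnectedSpace X]
    (Φ : X ≃ₘ⟮𝓡 4, (𝓡 1).prod (𝓡 3)⟯
      ((Metric.sphere (0 : EuclideanSpace ℝ (Fin 2)) 1) ×
        (Metric.sphere (0 : EuclideanSpace ℝ (Fin 4)) 1)))
    {ℓ : (Metric.sphere (0 : EuclideanSpace ℝ (Fin 2)) 1) → X}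
    (hℓ : Manifold.IsSmoothEmbedding (𝓡 1) (𝓡 4) ∞ ℓ)
    {M : Type} [TopologicalSpace M] [T2Space M] [SimplyConnectedSpace M]
    [ChartedSpace (EuclideanSpace ℝ (Fin 4)) M] [IsManifold (𝓡 4) ∞ M]
    (hsurg : IsCircleSurgery (𝓡 4) (𝓡 4) X M ℓ) :
    Nonempty (Diffeomorph (𝓡 4) (𝓡 4) M (Metric.sphere (0 : EuclideanSpace ℝ (Fin 5)) 1) ∞) := by
  haveI := ChartedSpace.locallyPathConnectedSpace (EuclideanSpace ℝ (Fin 4)) X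
  haveI : PathConnectedSpace X := pathConnectedSpace_iff_connectedSpace.2 ‹_›
  -- Step 3: the degree of `pr₁ ∘ Φ ∘ ℓ` is `±1`
  let ℓc : C(Metric.sphere (0 : EuclideanSpace ℝ (Fin 2)) 1, X) := ⟨ℓ, hℓ.isEmbedding.continuous⟩
  obtain ⟨eT, heT⟩ := exists_homeomorph_toCircle
  let T : C(Metric.sphere (0 : EuclideanSpace ℝ (Fin 2)) 1, Circle) := ⟨eT, eT.continuous⟩
  have hTu : ∀ u, T u = toCircle u := heT
  let Φc : C(X, (Metric.sphere (0 : EuclideanSpace ℝ (Fin 2)) 1) ×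
      (Metric.sphere (0 : EuclideanSpace ℝ (Fin 4)) 1)) := ⟨⇑Φ, Φ.continuous⟩
  let F : C(X, Circle) := T.comp ((⟨Prod.fst, continuous_fst⟩ : C(_, _)).comp Φc)
  have hF : ∃ (x : X) (γ : Path x x), winding F γ = 1 :=
    exists_winding_fst_eq_one Φ.toHomeomorph T hTu SphereFourSurgery.northPole
  have hd : winding F ℓc.circleLoop = 1 ∨ winding F ℓc.circleLoop = -1 :=
    winding_circleLoop_eq_one_or_neg_one_of_isCircleSurgery F hF ℓc hsurg
  have hd' : winding T ((⟨Prod.fst, continuous_fst⟩ : C(_, _)).comp (Φc.comp ℓc)).circleLoop = 1 ∨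
      winding T ((⟨Prod.fst, continuous_fst⟩ : C(_, _)).comp (Φc.comp ℓc)).circleLoop = -1 := by
    have : winding F ℓc.circleLoop =
        winding T ((⟨Prod.fst, continuous_fst⟩ : C(_, _)).comp (Φc.comp ℓc)).circleLoop :=
      winding_congr _ _ _ _ fun _ => rfl
    rwa [this] at hd
  -- hence `Φ ∘ ℓ` is homotopic to the fibre circle or its reverse
  have hhom := homotopic_fibre_or_conj_of_winding (Φc.comp ℓc) SphereFourSurgery.northPole T hTu hd'
  -- Step 4: the end-game on `S¹ × S³`
  exact nonempty_diffeomorph_sphereFour_of_isCircleSurgery_of_homotopic_fibre Φ ℓc hℓ hhom hsurg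

/-- **`msz_loopSurgery_homotopySphere_gk` from Meier–Schirmer–Zupan's classification theorem**
(Thm. 1.2; tree fact `msz_trisection_classification_gk`).  The printed argument (docstring of
the fact): `χ(X) = χ(M) − 2 = 0` pins the classification to `X ≅ S¹ × S³`
(`nonempty_diffeomorph_sphereOne_prod_sphereThree_of_classification`); `π₁(M) = 1` forces
`[ℓ] = ±1 ∈ π₁(S¹ × S³) = ℤ` (`winding_circleLoop_eq_one_or_neg_one_of_isCircleSurgery`,
Kosinski X Lemma 1.2), so `Φ ∘ ℓ` is homotopic to the fibre circle or its reverse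
(`homotopic_fibre_or_conj_of_winding`, Hatcher Thm. 1.7 and Prop. 1.14); homotopic loops in a
4-manifold are isotopic and both surgeries on the fibre circle of `S¹ × S³` are `S⁴` (Pao 1977,
Aranda–Zupan 2025 §2; `nonempty_diffeomorph_sphereFour_of_isCircleSurgery_of_homotopic_fibre`).
[cite: MeierSchirmerZupan2016, Thm. 1.2 (arXiv numbering)] [cite: Pao1977, Thm. (S_1 ≅ S'_1 ≅ S⁴)]
[cite: Kosinski1993, Ch. X §1, Lemma 1.2] -/
theorem msz_loopSurgery_homotopySphere_gk_of_classification
    (h : msz_trisection_classification_gk.{0}) : msz_loopSurgery_homotopySphere_gk := by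
  intro X _ _ _ _ _ _ _ hX g k S hT hk ℓ hℓ M _ _ _ _ _ e hsurg
  -- Steps 1–2: `X ≅ S¹ × S³`
  obtain ⟨Φ⟩ := nonempty_diffeomorph_sphereOne_prod_sphereThree_of_classification h hX hT hk e hsurg
  -- Steps 3–4
  haveI : SimplyConnectedSpace (Metric.sphere (0 : EuclideanSpace ℝ (Fin 5)) 1) :=
    simplyConnectedSpace_sphere_four_holds
  haveI : SimplyConnectedSpace M := e.simplyConnectedSpace
  exact nonempty_diffeomorph_sphereFour_of_isCircleSurgery_of_diffeomorph_sphereOne_prod_sphereThree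
    Φ hℓ hsurg

/-- **`msz_loopSurgery_homotopySphere_gk` from the `χ = 0` slice of Meier–Schirmer–Zupan's
classification** (tree fact `msz_chiZero_circleProdSphereThree_gk`, `SmallTrisectionsChiZero.lean`:
a closed connected oriented trisected `X` with some `kᵢ + 1 ≥ g` and `k₀ + k₁ + k₂ = g + 2` is
diffeomorphic to `S¹ × S³`).  For the loop partner `X` of the homotopy 4-sphere `M = X_ℓ` the
hypothesis `k₀ + k₁ + k₂ = g + 2` (`χ(X) = χ(M) − 2 = 0`, Gay–Kirby Remark 2 with Gompf–Stipsicz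
§5.2) is the PROVED `gkTrisection_sum_eq_add_two_of_loopSurgery_homotopySphere_holds`; then
steps 3–4 of the printed argument apply verbatim
(`nonempty_diffeomorph_sphereFour_of_isCircleSurgery_of_diffeomorph_sphereOne_prod_sphereThree`).
Since the classification implies its `χ = 0` slice (`SmallTrisectionsChiZeroProofs.lean`), a
proof of EITHER named fact discharges `msz_loopSurgery_homotopySphere_gk`.
[cite: MeierSchirmerZupan2016, Thm. 1.2 (arXiv numbering) and Remark 3.12]
[cite: Pao1977, Thm. (S_1 ≅ S'_1 ≅ S⁴)] [cite: Kosinski1993, Ch. X §1, Lemma 1.2] -/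
theorem msz_loopSurgery_homotopySphere_gk_of_chiZero
    (h : msz_chiZero_circleProdSphereThree_gk.{0}) : msz_loopSurgery_homotopySphere_gk := by
  intro X _ _ _ _ _ _ _ hX g k S hT hk ℓ hℓ M _ _ _ _ _ e hsurg
  -- Step 1: `χ(X) = 0`, i.e. `k₀ + k₁ + k₂ = g + 2`
  have hsum : k 0 + k 1 + k 2 = g + 2 :=
    gkTrisection_sum_eq_add_two_of_loopSurgery_homotopySphere_holds X hX g k S hT ℓ hℓ M e hsurg
  -- Step 2: `X ≅ S¹ × S³` by the `χ = 0` slice of the classification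
  obtain ⟨o⟩ := hX
  obtain ⟨Φ⟩ := h X o g k S hT hk hsum
  -- Steps 3–4
  haveI : SimplyConnectedSpace (Metric.sphere (0 : EuclideanSpace ℝ (Fin 5)) 1) :=
    simplyConnectedSpace_sphere_four_holds
  haveI : SimplyConnectedSpace M := e.simplyConnectedSpace
  exact nonempty_diffeomorph_sphereFour_of_isCircleSurgery_of_diffeomorph_sphereOne_prod_sphereThree
    Φ hℓ hsurg

end Literature.Topology.FourManifolds

end
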